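import Summits.ResolutionOfSingularities.ResolutionOfSingularities.Theorems.EquisingularLiftEquisingularLiftNatOrdTwoOneBlowupChart
import HarnessLib

/-!
# [OURS · L1 W4.5(b)] L-ORD2, part 2: «ORDER-2 CURVES RESOLVE IN ONE BLOW-UP, GENERICALLY» — both
# charts and the headline — crux `EquisingularLiftNat` (EL♮, stmt-ResolutionOfSingularities-20038),
# line `sections`, research stub `stub_elnat_three` / conditional rung T-ORD

NOT a statement of any manuscript. Object (R5) OPTION L-ORD2 of res-L1-w45b-plan-1's ORDERS
2026-08-27T05:49:16Z, assembled from part 1 (`…OrdTwoOneBlowupChart`: controlled `=` strict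
transform, tangent separation upstairs, Bertini upstairs on one chart) and g8's H-L0b files
(`…OccursAsSingularLocus` p500339, `…Transversal` p502343).

* `isGeneric_isRegularRing_blowup_pair` — BOTH CHARTS: for `A` regular of finite type over `k = k̄`,
  `x = (x₀, x₁)` a quasi-regular pair generating a prime `I` with `A/I` regular, and a presented
  `I²`-system containing `x₀x₁`, `x₀²`, `x₁²`, `g x₀²`, `g x₁²` (`g` over `k`-algebra generators of
  `A`): for GENERIC `t` both affine chart rings `(A/(s_t))[Ī/x̄₀]`, `(A/(s_t))[Ī/x̄₁]` of
  `Bl_{V(I)} V(s_t)` are regular rings;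
* `surjective_linCombQuotSq_of_unit_row`, `exists_ordTwoSystem` — the affine `(y, z)²`-system
  `{g y², g yz, g z² : g ∈ {1} ∪ s}` PRESENTED, with the members above, separating tangent vectors at
  every closed point off `V(y, z)` (the shape of g8's `exists_sqSystem`);
* `ordTwo_generic_oneBlowup_regular` — **L-ORD2 HEADLINE**: `A` a regular domain of finite type over
  `k = k̄`, `x = (x₀, x₁)` quasi-regular with `x₀x₁ ≠ 0` generating a prime `I` with `A/I` regular (a
  chart of a smooth irreducible curve `Σ` in a smooth variety, `Σ` cut out by two coordinates). Then
  finitely many `u_l ∈ I²` exist such that for GENERIC `t` (non-vacuous: `k` infinite): `s_t ≠ 0`,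
  `s_t ∈ I²`, the closed singular locus of `H_t = V(s_t)` is EXACTLY `V(I)` (g8's Bertini off `V(I)`,
  `isGeneric_isRegularLocalRing_quotient_linComb_off`, + Matsumura 14.2,
  `not_isRegularLocalRing_quotient_of_mem_sq`), **and both affine charts of `Bl_Σ H_t` are regular
  rings — ONE blow-up along the double curve resolves the generic member of the `I²`-system**;
  `exists_hypersurface_singular_along_resolved_by_one_blowup` — a witness `s` exists;
* `ordTwo_generic_package` (rev 2, append-only) — ONE generic `t` for ALL clauses of H-L0b on the
  chart at once, adding g8's transversal-`A₁`-off-finitely-many-points clause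
  (`occurs_as_singular_locus_transversalA1`, p502343) under `dim A/I ≤ 1`.

NOT covered, and said so: irreducibility of `H_t` for `d ≫ 0` (Bertini-irreducibility class), the
projective gluing of the affine charts (finite intersection of generic conditions on one coefficient
space), and the explicit four-condition form of the pointwise criterion (a) for a SPECIFIC
non-generic `F` (T-ORD's ordinary-singularity check downstairs). References: [Hartshorne1977] II
Thm. 8.18; [Liu2002] Thm. 8.1.19 (a); [Matsumura1987] Thm. 14.2, 19.3. [folklore]-level commutative
algebra over the tree; axioms standard. AI-produced formalisation, weaker than expert review.
-/

set_option linter.dupNamespace false -- mandated namespace `Summit.<Summit>.<Problem>` of this single-conjunct summit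

noncomputable section

open IsLocalRing MvPolynomial

universe u v

namespace Summit.ResolutionOfSingularities.ResolutionOfSingularities.Cruxes.EquisingularLiftNat.Sections

open Literature.AlgebraicGeometry.Resolution Literature.AlgebraicGeometry.Resolution.BertiniAffine

variable {k : Type u} [Field k] {A : Type u} [CommRing A] [Algebra k A]
variable {ι : Type v} [Fintype ι]

/-! ## Both charts: the blow-up of the generic member along `V(x₀, x₁)` is regular -/

/-- **L-ORD2, both charts.** Let `A` be regular of finite type over `k = k̄`, `x = (x₀, x₁)` a
quasi-regular pair generating a prime `I` with `A/I` regular, and `u_l = a_l x₀² + b_l x₀x₁ + c_l x₁²`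
a presented `I²`-system containing `x₀x₁`, `x₀²`, `x₁²` and the members `g x₀²`, `g x₁²` for `g`
over a set of `k`-algebra generators of `A`. Then for GENERIC `t` BOTH affine chart rings
`(A/(s_t))[Ī/x̄₀]`, `(A/(s_t))[Ī/x̄₁]` of the blow-up of the hypersurface `V(s_t)` along `V(I)` are
regular rings: **the blow-up of `V(s_t)` along the curve `V(I) ⊆ Sing V(s_t)` is regular**.
[cite: Hartshorne1977, II Thm. 8.18] [cite: Liu2002, Thm. 8.1.19 (a)] [OURS · L1 W4.5b] helper
L-ORD2; NOT a statement of the manuscript. -/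
theorem isGeneric_isRegularRing_blowup_pair [IsAlgClosed k] [IsRegularRing A]
    [Algebra.FiniteType k A] (x : Fin 2 → A) (hx : IsQuasiRegular x)
    [(Ideal.span (Set.range x)).IsPrime] [IsRegularRing (A ⧸ Ideal.span (Set.range x))]
    (u a b c : ι → A) (hu : ∀ l, u l = a l * x 0 ^ 2 + b l * (x 0 * x 1) + c l * x 1 ^ 2)
    (hT : ∃ l, a l = 0 ∧ b l = 1 ∧ c l = 0) (h0 : ∃ l, a l = 1 ∧ b l = 0 ∧ c l = 0)
    (h1 : ∃ l, a l = 0 ∧ b l = 0 ∧ c l = 1)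
    (hrich : ∃ s : Set A, Algebra.adjoin k s = ⊤ ∧ ∀ g ∈ s,
      (∃ l, a l = g ∧ b l = 0 ∧ c l = 0) ∧ (∃ l, a l = 0 ∧ b l = 0 ∧ c l = g)) :
    IsGeneric fun t : ι → k => ∀ i : Fin 2,
      IsRegularRing (blowupAlgebra ((Ideal.span (Set.range x)).map
          (Ideal.Quotient.mk (Ideal.span {linComb u t})))
        (Ideal.Quotient.mk (Ideal.span {linComb u t}) (x i))) := by
  obtain ⟨s, hs, hsg⟩ := hrich
  -- chart `x₁ ≠ 0` (`i = 1`, `j = 0`): presentation `(a, b, c)`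
  have hc1 := isGeneric_isRegularRing_blowup_chart (k := k) x 1 0 (by decide) hx u a b c hu hT h1
    ⟨s, hs, fun g hg => (hsg g hg).2⟩
  -- chart `x₀ ≠ 0` (`i = 0`, `j = 1`): presentation `(c, b, a)`
  have hu' : ∀ l, u l = c l * x 1 ^ 2 + b l * (x 1 * x 0) + a l * x 0 ^ 2 := fun l => by
    rw [hu l]; ring
  have hT' : ∃ l, c l = 0 ∧ b l = 1 ∧ a l = 0 := by
    obtain ⟨l, ha, hb, hc⟩ := hT; exact ⟨l, hc, hb, ha⟩
  have h0' : ∃ l, c l = 0 ∧ b l = 0 ∧ a l = 1 := by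
    obtain ⟨l, ha, hb, hc⟩ := h0; exact ⟨l, hc, hb, ha⟩
  have hc0 := isGeneric_isRegularRing_blowup_chart (k := k) x 0 1 (by decide) hx u c b a hu' hT' h0'
    ⟨s, hs, fun g hg => by obtain ⟨l, ha, hb, hc⟩ := (hsg g hg).1; exact ⟨l, hc, hb, ha⟩⟩
  refine (hc0.and hc1).mono fun t ht i => ?_
  fin_cases i
  · exact ht.1.2.2
  · exact ht.2.2.2

/-! ## The affine `(y, z)²`-system `{g·y², g·yz, g·z² : g ∈ {1} ∪ s}` -/

/-- **A presented row with a unit separates tangent vectors.** If for some `m₀` the members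
`u (m₀, o) = g_o · e` (`g_none = 1`, `g_{some x} = x` over `k`-algebra generators `s` of `A`) with
`e ∉ 𝔪`, then `t ↦ s_t mod 𝔪²` is onto `A ⧸ 𝔪²`. [folklore] [OURS · L1 W4.5b] -/
theorem surjective_linCombQuotSq_of_unit_row [IsAlgClosed k] [Algebra.FiniteType k A]
    {s : Finset A} (hs : Algebra.adjoin k (s : Set A) = ⊤) {κ : Type v} [Fintype κ]
    [DecidableEq κ] (u : κ × Option ↥s → A) (𝔪 : Ideal A) [𝔪.IsMaximal] (m₀ : κ) {e : A}
    (he : e ∉ 𝔪) (hrow : ∀ o, u (m₀, o) = o.elim (1 : A) Subtype.val * e) :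
    Function.Surjective (linCombQuotSq (k := k) u 𝔪) := by
  classical
  -- `1, x₁, …, xₙ` separate tangent vectors at `𝔪`
  have hgen : Algebra.adjoin k (Set.range (fun o : Option ↥s => o.elim (1 : A) Subtype.val)) = ⊤ := by
    refine top_le_iff.1 (hs ▸ Algebra.adjoin_mono fun x hx => ?_)
    exact ⟨some ⟨x, hx⟩, rfl⟩
  have hv : Function.Surjective
      (linCombQuotSq (k := k) (fun o : Option ↥s => o.elim (1 : A) Subtype.val) 𝔪) :=
    surjective_linCombQuotSq_of_adjoin_eq_top _ hgen (j₀ := none) rfl 𝔪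
  -- `e` is a unit modulo `𝔪²`
  have hunit : IsUnit (Ideal.Quotient.mk (𝔪 ^ 2) e) :=
    (Ideal.Quotient.isUnit_mk_pow_iff_notMem 𝔪 two_ne_zero).2 he
  obtain ⟨d, hd⟩ := hunit.exists_left_inv
  intro w
  obtain ⟨t', ht'⟩ := hv (d * w)
  let t : κ × Option ↥s → k := fun p => if p.1 = m₀ then t' p.2 else 0
  have hlin : linComb u t = linComb (fun o : Option ↥s => o.elim (1 : A) Subtype.val) t' * e := by
    unfold linComb
    rw [Fintype.sum_prod_type, Finset.sum_eq_single m₀, Finset.sum_mul]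
    · refine Finset.sum_congr rfl fun o _ => ?_
      simp only [t, if_true, hrow, smul_mul_assoc]
    · intro m _ hm
      refine Finset.sum_eq_zero fun o _ => ?_
      simp only [t]
      rw [if_neg hm, zero_smul]
    · intro h
      exact absurd (Finset.mem_univ _) h
  refine ⟨t, ?_⟩
  rw [linCombQuotSq_apply, hlin, map_mul, ← linCombQuotSq_apply, ht', mul_assoc, mul_comm w,
    ← mul_assoc, hd, one_mul]

/-- **The affine `(y, z)²`-system.** For `A` of finite type over `k = k̄` and `y, z ∈ A` there is a
presented system `u_l = a_l y² + b_l yz + c_l z²` (namely `{g y², g yz, g z²}` for `g` running over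
`1` and a finite set of `k`-algebra generators) containing `yz`, `y²`, `z²`, the `g y²` and the
`g z²`, and separating tangent vectors at every closed point `𝔪 ⊉ (y, z)`. [folklore]
[OURS · L1 W4.5b] helper L-ORD2. -/
theorem exists_ordTwoSystem [IsAlgClosed k] [Algebra.FiniteType k A] (y z : A) :
    ∃ (ι : Type u) (_ : Fintype ι) (u a b c : ι → A),
      (∀ l, u l = a l * y ^ 2 + b l * (y * z) + c l * z ^ 2) ∧
      (∃ l, a l = 0 ∧ b l = 1 ∧ c l = 0) ∧ (∃ l, a l = 1 ∧ b l = 0 ∧ c l = 0) ∧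
      (∃ l, a l = 0 ∧ b l = 0 ∧ c l = 1) ∧
      (∃ s : Set A, Algebra.adjoin k s = ⊤ ∧ ∀ g ∈ s,
        (∃ l, a l = g ∧ b l = 0 ∧ c l = 0) ∧ (∃ l, a l = 0 ∧ b l = 0 ∧ c l = g)) ∧
      ∀ 𝔪 : Ideal A, 𝔪.IsMaximal → ¬ Ideal.span {y, z} ≤ 𝔪 →
        Function.Surjective (linCombQuotSq (k := k) u 𝔪) := by
  classical
  obtain ⟨s, hs⟩ := (Algebra.FiniteType.out : (⊤ : Subalgebra k A).FG)
  let g : Option ↥s → A := fun o => o.elim (1 : A) Subtype.val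
  let a : Fin 3 × Option ↥s → A := fun p => if p.1 = 0 then g p.2 else 0
  let b : Fin 3 × Option ↥s → A := fun p => if p.1 = 1 then g p.2 else 0
  let c : Fin 3 × Option ↥s → A := fun p => if p.1 = 2 then g p.2 else 0
  let u : Fin 3 × Option ↥s → A := fun p => a p * y ^ 2 + b p * (y * z) + c p * z ^ 2
  refine ⟨Fin 3 × Option ↥s, inferInstance, u, a, b, c, fun l => rfl,
    ⟨(1, none), by simp [a, b, c, g]⟩, ⟨(0, none), by simp [a, b, c, g]⟩,
    ⟨(2, none), by simp [a, b, c, g]⟩,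
    ⟨(s : Set A), hs, fun x hx => ⟨⟨(0, some ⟨x, hx⟩), by simp [a, b, c, g]⟩,
      ⟨(2, some ⟨x, hx⟩), by simp [a, b, c, g]⟩⟩⟩, fun 𝔪 h𝔪 hyz => ?_⟩
  -- at a closed point off `V(y, z)`, `y` or `z` is a unit
  have hcases : y ∉ 𝔪 ∨ z ∉ 𝔪 := by
    by_contra hcon
    push Not at hcon
    exact hyz (Ideal.span_le.2 (Set.pair_subset_iff.2 hcon))
  rcases hcases with hy | hz
  · refine surjective_linCombQuotSq_of_unit_row (k := k) hs u 𝔪 0 (e := y ^ 2)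
      (fun h => hy ((Ideal.IsPrime.pow_mem_iff_mem inferInstance 2 two_pos).1 h)) fun o => ?_
    simp [u, a, b, c, g]
  · refine surjective_linCombQuotSq_of_unit_row (k := k) hs u 𝔪 2 (e := z ^ 2)
      (fun h => hz ((Ideal.IsPrime.pow_mem_iff_mem inferInstance 2 two_pos).1 h)) fun o => ?_
    simp [u, a, b, c, g]

/-! ## L-ORD2: the generic hypersurface singular to order `2` along a smooth curve is resolved by
one blow-up along the curve -/

omit [CommRing A] [Algebra k A] in
/-- `Set.range (x₀, x₁) = {x₀, x₁}`. [folklore] -/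
theorem range_fin_two (x : Fin 2 → A) : Set.range x = {x 0, x 1} := by
  ext w
  simp only [Set.mem_range, Fin.exists_fin_two, Set.mem_insert_iff, Set.mem_singleton_iff, eq_comm]

/-- **L-ORD2 «ORDER-2 CURVES RESOLVE IN ONE BLOW-UP, GENERICALLY» (affine kernel core, both
charts).** Let `A` be a regular domain of finite type over an algebraically closed field `k` (a chart
of a smooth threefold, or of any smooth variety), and `x = (x₀, x₁)` a quasi-regular pair with
`x₀x₁ ≠ 0` generating a prime ideal `I` with `A/I` regular (the chart of a smooth irreducible curve
`Σ = V(I)` cut out by two of the local coordinates). Then there are finitely many `u_l ∈ I²` (the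
affine `I²`-system `{g x₀², g x₀x₁, g x₁²}`) such that for GENERIC coefficient vectors `t` (off the
zeros of a non-zero polynomial; `k` is infinite, so such `t` exist): `s_t = Σ t_l u_l ≠ 0`, `s_t ∈ I²`;
for every closed point `𝔪 ∋ s_t` the local ring `A_𝔪 ⧸ (s_t)` is regular **iff** `𝔪 ⊉ I` (the
closed singular locus of the hypersurface `H_t = V(s_t)` is exactly `Σ`, along which `H_t` has
order `≥ 2`); **and both affine chart rings `(A/(s_t))[Ī/x̄₀]`, `(A/(s_t))[Ī/x̄₁]` of the blow-up
`Bl_Σ H_t` are regular rings — ONE blow-up along `Σ` resolves `H_t`.** Proof: g8's Bertini off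
`V(I)` + Matsumura 14.2 downstairs (`isGeneric_isRegularLocalRing_quotient_linComb_off`,
`not_isRegularLocalRing_quotient_of_mem_sq`), and UPSTAIRS the tree's affine Bertini on the regular
chart `A[I/xᵢ]` applied to the linear system of controlled transforms, which are the strict
transforms for generic `t` (`isGeneric_isRegularRing_blowup_pair`). NOT covered here (said so):
irreducibility of `H_t`, transversal type off finitely many points (see p502343), projective gluing
of charts. [cite: Hartshorne1977, II Thm. 8.18] [cite: Liu2002, Thm. 8.1.19 (a)]
[cite: Matsumura1987, Thm. 14.2, Thm. 19.3] [OURS · L1 W4.5b] helper L-ORD2 (res-L1-w45b-plan-1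
ORDERS (R5)) toward `stub_elnat_three` / T-ORD of crux `EquisingularLiftNat`
(stmt-ResolutionOfSingularities-20038); NOT a statement of the manuscript. -/
theorem ordTwo_generic_oneBlowup_regular [IsAlgClosed k] [IsRegularRing A] [IsDomain A]
    [Algebra.FiniteType k A] (x : Fin 2 → A) (hx : IsQuasiRegular x) (hx0 : x 0 * x 1 ≠ 0)
    [(Ideal.span (Set.range x)).IsPrime] [IsRegularRing (A ⧸ Ideal.span (Set.range x))] :
    ∃ (ι : Type u) (_ : Fintype ι) (u : ι → A), (∀ l, u l ∈ Ideal.span (Set.range x) ^ 2) ∧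
      IsGeneric fun t : ι → k =>
        linComb u t ≠ 0 ∧ linComb u t ∈ Ideal.span (Set.range x) ^ 2 ∧
        (∀ (𝔪 : Ideal A) [𝔪.IsMaximal], linComb u t ∈ 𝔪 →
          (IsRegularLocalRing (Localization.AtPrime 𝔪 ⧸
              Ideal.span {algebraMap A (Localization.AtPrime 𝔪) (linComb u t)}) ↔
            ¬ Ideal.span (Set.range x) ≤ 𝔪)) ∧
        ∀ i : Fin 2, IsRegularRing (blowupAlgebra ((Ideal.span (Set.range x)).map
            (Ideal.Quotient.mk (Ideal.span {linComb u t})))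
          (Ideal.Quotient.mk (Ideal.span {linComb u t}) (x i))) := by
  classical
  obtain ⟨ι, hι, u, a, b, c, hu, hT, h0, h1, hrich, hoff⟩ := exists_ordTwoSystem (k := k) (x 0) (x 1)
  have hspan : Ideal.span (Set.range x) = Ideal.span {x 0, x 1} := by rw [range_fin_two]
  have h0m : x 0 ∈ Ideal.span (Set.range x) := Ideal.subset_span ⟨0, rfl⟩
  have h1m : x 1 ∈ Ideal.span (Set.range x) := Ideal.subset_span ⟨1, rfl⟩
  have humem : ∀ l, u l ∈ Ideal.span (Set.range x) ^ 2 := by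
    intro l
    rw [hu l, pow_two (Ideal.span (Set.range x))]
    refine add_mem (add_mem ?_ ?_) ?_
    · rw [pow_two]; exact Ideal.mul_mem_left _ _ (Ideal.mul_mem_mul h0m h0m)
    · exact Ideal.mul_mem_left _ _ (Ideal.mul_mem_mul h0m h1m)
    · rw [pow_two]; exact Ideal.mul_mem_left _ _ (Ideal.mul_mem_mul h1m h1m)
  refine ⟨ι, hι, u, humem, ?_⟩
  have hmem : ∀ t : ι → k, linComb u t ∈ Ideal.span (Set.range x) ^ 2 := fun t =>
    Ideal.sum_mem _ fun l _ => by rw [Algebra.smul_def]; exact Ideal.mul_mem_left _ _ (humem l)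
  -- downstairs: Bertini off `V(I)` and `s_t ≠ 0`
  have hA := isGeneric_isRegularLocalRing_quotient_linComb_off (k := k) (Ideal.span (Set.range x)) u
    fun 𝔪 h𝔪 hI => hoff 𝔪 h𝔪 (hspan ▸ hI)
  have hne : ∃ l, u l ≠ 0 := by
    obtain ⟨l, ha, hb, hc⟩ := hT
    refine ⟨l, ?_⟩
    rw [hu l, ha, hb, hc]
    simpa using hx0
  have hB := isGeneric_linComb_ne_zero (k := k) u hne
  -- upstairs: both charts
  have hC := isGeneric_isRegularRing_blowup_pair (k := k) x hx u a b c hu hT h0 h1 hrich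
  refine ((hA.and hB).and hC).mono fun t ht => ⟨ht.1.2, hmem t, fun 𝔪 h𝔪 hst =>
    ⟨fun hreg hI => ?_, fun hI => ht.1.1 𝔪 hI hst⟩, ht.2⟩
  exact not_isRegularLocalRing_quotient_of_mem_sq 𝔪 ht.1.2
    (Ideal.pow_right_mono hI 2 (hmem t)) hreg

/-- **Corollary (a witness exists).** Under the hypotheses of `ordTwo_generic_oneBlowup_regular`
some non-zero `s ∈ I²` has closed singular locus exactly `V(I) ∩ MaxSpec A` AND a regular blow-up
along `V(I)` on both charts (`k` is infinite, `IsGeneric.nonempty`). [OURS · L1 W4.5b] helper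
L-ORD2; NOT a statement of the manuscript. -/
theorem exists_hypersurface_singular_along_resolved_by_one_blowup [IsAlgClosed k] [IsRegularRing A]
    [IsDomain A] [Algebra.FiniteType k A] (x : Fin 2 → A) (hx : IsQuasiRegular x)
    (hx0 : x 0 * x 1 ≠ 0) [(Ideal.span (Set.range x)).IsPrime]
    [IsRegularRing (A ⧸ Ideal.span (Set.range x))] :
    ∃ s : A, s ≠ 0 ∧ s ∈ Ideal.span (Set.range x) ^ 2 ∧
      (∀ (𝔪 : Ideal A) [𝔪.IsMaximal], s ∈ 𝔪 →
        (IsRegularLocalRing (Localization.AtPrime 𝔪 ⧸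
            Ideal.span {algebraMap A (Localization.AtPrime 𝔪) s}) ↔ ¬ Ideal.span (Set.range x) ≤ 𝔪)) ∧
      ∀ i : Fin 2, IsRegularRing (blowupAlgebra ((Ideal.span (Set.range x)).map
          (Ideal.Quotient.mk (Ideal.span {s}))) (Ideal.Quotient.mk (Ideal.span {s}) (x i))) := by
  obtain ⟨ι, hι, u, -, hgen⟩ := ordTwo_generic_oneBlowup_regular (k := k) x hx hx0
  haveI : Infinite k := IsAlgClosed.instInfinite
  obtain ⟨t, ht⟩ := hgen.nonempty
  exact ⟨linComb u t, ht.1, ht.2.1, fun 𝔪 h𝔪 hst => ht.2.2.1 𝔪 hst, ht.2.2.2⟩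

/-! ## The H-L0b package on a complete-intersection chart: one coefficient vector for all clauses
(rev 2, append-only) -/

/-- **H-L0b + L-ORD2 PACKAGE, one generic `t` for every clause** (rev 2 add-on). In the setting of
`ordTwo_generic_oneBlowup_regular` with moreover `dim A/I ≤ 1` (a curve), the presented affine
`I²`-system of `exists_ordTwoSystem` satisfies, for GENERIC `t` — ONE coefficient vector for all
clauses at once —: `s_t ≠ 0`; `s_t ∈ I²`; the closed singular locus of `H_t = V(s_t)` is exactly
`V(I)`; the transversal discriminant `D_t = b_t² − 4 a_t c_t ∉ I` and the closed points of `V(I)`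
containing `D_t` are finite (**transversal type `A₁` off finitely many points of `Σ`**, g8's
`occurs_as_singular_locus_transversalA1`, p502343); **and both affine charts of `Bl_Σ H_t` are
regular rings** (`isGeneric_isRegularRing_blowup_pair`). [cite: Hartshorne1977, II Thm. 8.18]
[cite: Liu2002, Thm. 8.1.19 (a)] [cite: Matsumura1987, Thm. 14.2] [OURS · L1 W4.5b] helper L-ORD2 /
H-L0b toward `stub_elnat_three` of crux `EquisingularLiftNat` (stmt-ResolutionOfSingularities-20038);
NOT a statement of the manuscript. -/
theorem ordTwo_generic_package [IsAlgClosed k] [IsRegularRing A] [IsDomain A]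
    [Algebra.FiniteType k A] (x : Fin 2 → A) (hx : IsQuasiRegular x) (hx0 : x 0 * x 1 ≠ 0)
    [(Ideal.span (Set.range x)).IsPrime] [IsRegularRing (A ⧸ Ideal.span (Set.range x))]
    (hdim : ringKrullDim (A ⧸ Ideal.span (Set.range x)) ≤ 1) :
    ∃ (ι : Type u) (_ : Fintype ι) (u a b c : ι → A),
      (∀ l, u l = a l * x 0 ^ 2 + b l * (x 0 * x 1) + c l * x 1 ^ 2) ∧
      IsGeneric fun t : ι → k =>
        linComb u t ≠ 0 ∧ linComb u t ∈ Ideal.span (Set.range x) ^ 2 ∧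
        (∀ (𝔪 : Ideal A) [𝔪.IsMaximal], linComb u t ∈ 𝔪 →
          (IsRegularLocalRing (Localization.AtPrime 𝔪 ⧸
              Ideal.span {algebraMap A (Localization.AtPrime 𝔪) (linComb u t)}) ↔
            ¬ Ideal.span (Set.range x) ≤ 𝔪)) ∧
        (linComb b t ^ 2 - 4 * linComb a t * linComb c t ∉ Ideal.span (Set.range x) ∧
          {𝔪 : Ideal A | 𝔪.IsMaximal ∧ Ideal.span (Set.range x) ≤ 𝔪 ∧
            linComb b t ^ 2 - 4 * linComb a t * linComb c t ∈ 𝔪}.Finite) ∧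
        ∀ i : Fin 2, IsRegularRing (blowupAlgebra ((Ideal.span (Set.range x)).map
            (Ideal.Quotient.mk (Ideal.span {linComb u t})))
          (Ideal.Quotient.mk (Ideal.span {linComb u t}) (x i))) := by
  classical
  obtain ⟨ι, hι, u, a, b, c, hu, hT, h0, h1, hrich, hoff⟩ := exists_ordTwoSystem (k := k) (x 0) (x 1)
  have hspan : Ideal.span (Set.range x) = Ideal.span {x 0, x 1} := by rw [range_fin_two]
  refine ⟨ι, hι, u, a, b, c, hu, ?_⟩
  -- downstairs: g8's H-L0b with the transversal clause
  have hA := occurs_as_singular_locus_transversalA1 (k := k) (Ideal.span (Set.range x)) hdim hspan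
    hx0 u a b c hu hT fun 𝔪 h𝔪 hI => hoff 𝔪 h𝔪 (hspan ▸ hI)
  -- upstairs: both charts
  have hC := isGeneric_isRegularRing_blowup_pair (k := k) x hx u a b c hu hT h0 h1 hrich
  refine (hA.and hC).mono fun t ht => ⟨ht.1.1, ht.1.2.1, fun 𝔪 h𝔪 hst => ht.1.2.2.1 𝔪 hst,
    ⟨ht.1.2.2.2.1, ht.1.2.2.2.2⟩, ht.2⟩

end Summit.ResolutionOfSingularities.ResolutionOfSingularities.Cruxes.EquisingularLiftNat.Sections

end
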